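import Literature.AnabelianGeometry.EtaleTheta.Discharge.Sec4Thm44SchemaCertificates
import Literature.AnabelianGeometry.SemiGraphs.TemperedArithmeticGroupPadicWitness
import Literature.AnabelianGeometry.AbsoluteAnabelian.MLFAbsoluteGaloisGroupInfinite
import HarnessLib

/-!
# [EtTh] Theorem 4.4 (i) as typed (`Thm44_i`): schema certificate — the universal closure is FALSE
# (kernel `¬ ∀`), lever T44-L09; the instance forms that hold are cited

S. Mochizuki, *The étale theta function and its Frobenioid-theoretic manifestations*, Publ. RIMS **45**
(2009) [MochizukiEtTh2009], §4, Theorem 4.4 (i), PDF p.94 (printed p.320); proof p.95 ll.4–6.  Print, (i):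
"`Ψ` maps isomorphs of `A_{⊙,1}` to isomorphs of `A_{⊙,2}` and `H_{⊙,1}`-ample objects to `H_{⊙,2}`-ample objects;
`Ψ^bs` induces an isomorphism `H_{⊙,1} ⥲ H_{⊙,2}`, which is well-defined up to composition with inner
automorphisms of `Π^tp_{X_i}`."

abc-iut cell, block F (fact-proving wave), trunk `BiKummerRoots.lean`, FACT-LIST row **F-0493**
(`BiKummerSetting.Thm44_i`, typed by abc-iut-L2-t3 over the §4 hypothesis structure `BiKummerSetting`; statement
file untouched — this is a PROOF-ONLY companion: theorems only, all witness data built inline in the proofs; no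
definition, no named fact, no instance, no `sorry`).  Sequel of `Sec4Thm44SchemaCertificates.lean` (rows F-0494 /
F-0495, clauses (ii) / (iii)).

## What is certified (plan R5: a parametrised schema is a fact only at named instances)

`Thm44_i h` is a SCHEMA over two settings `S₁, S₂` and a hypothesis package `h : Thm44Hyp S₁ S₂`.  Its third
clause renders print's "`Ψ^bs` induces `H_{⊙,1} ⥲ H_{⊙,2}`" by `Nonempty (S₁.Hodot ≃* S₂.Hodot)`.  In print the
base categories ARE `D_i = B^temp(Π^tp_{X_i})⁰[𝒟_i]`, so `Ψ^bs : D₁ ⥲ D₂` induces `Π^tp_{X₁} ⥲ Π^tp_{X₂}` (outer)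
by [SemiAnbd] Prop 3.2 / Thm A.4 — sub-DAG row T44-L09 (`Thm44Hyp.HodotCompatible`, plan/L2/SUBDAG-EtTh-Thm44.md).
As TYPED, `Thm44Hyp` ties `Π^tp_{X_i}` to `D_i` only through the field `galoisSurj : Π^tp_X ↠ Aut_D(A^bs)`
(`baseShape_i` speaks of an abstract `D₀`, not of `B^temp(Π^tp_{X_i})`), which carries no information when
`Aut_D(A^bs)` is trivial.

1. **Universal closure REFUTED in kernel** (`not_forall_thm44_i`, universe level `0`): the two canonical-model
   settings (`BiKummerSetting.mkOfModelCanonical`, abc-iut-L2-t9) over the SAME perfect toy tempered Frobenioid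
   `Toy.temperedFrobenioidQ` of `Discharge/Sec4NonVacuity.lean` (one-object base `D = D₀ = Discrete PUnit`,
   Galois objects := all, `Π^tp_X ↠ Aut_D(A^bs)` := trivial) but over DIFFERENT tempered groups —
   `Π₁ := G_{ℚ̄} = Gal(ℚ̄̄/ℚ̄)` (trivial; the degenerate inhabitant pattern of `TemperedCurvesWitness.lean`) and
   `Π₂ := G_{ℚ₂} = Gal(ℚ̄₂/ℚ₂)` with the identity augmentation (abc-iut-w5-d218's arithmetically genuine
   inhabitant pattern `TemperedArithmeticGroup.nonempty_model_padic`: profinite hence tempered, SLIM by the tree's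
   theorem `galoisMLF_slim_holds`, Galois-countable by `secondCountableTopology_absoluteGaloisGroup_padic`) — and
   `Ψ = Ψ^bs = 𝟭`.  Every field of `Thm44Hyp` holds (as for `Toy.thm44HypId`), clauses 1 and 2 of (i) hold
   trivially, but `H_{⊙,1} = Π₁` is trivial while `H_{⊙,2} = Π₂` is infinite (`Padic.infinite_absoluteGaloisGroup`),
   so clause 3 fails.  So the FACT-LIST row may NOT be bound as a closed hypothesis `(h : ∀ …, Thm44_i …)` of a
   certificate (it would make the certificate vacuous).  (This corrects the tranche-109 census line «universal
   closures of F-0492/F-0493 undecidable with present tree objects — every constructible `TemperedArithmeticGroup`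
   has trivial `Π^tp`»: the tree holds a non-trivial one.)
2. **Instance forms that HOLD** (tree, cited not restated): `Thm44Hyp.thm44_i_of` / `thm44_i_of_inputs`
   (`BiKummerThm44Sub.lean`: (i) ⇐ T44-L07 ∧ L08 ∧ L09), `thm44_i_of_thm34` (`BiKummerThm44SubFrdI.lean`),
   `thm44_i_treeVocab` (`BiKummerThm44SubTree.lean`), `thm44_i_ofEmbedded` / `thm44_i_ofTemperoid` /
   `thm44_i_mkOfConnectedTemperoid` (`Discharge/Sec4Thm44GaloisCompatibleOf*.lean`, `Sec4Thm44OfConnectedTemperoid.lean`: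
   UNCONDITIONAL over the genuine connected temperoid base `B^temp(Π^tp_X)⁰`, where T44-L09 is a theorem),
   and the toy model witness `Toy.thm44_i_id`.  The lever of 1. is exactly the residual hypothesis T44-L09 of 2.:
   it is NECESSARY.

HONEST FRAMING: [EtTh] is refereed, pre-IUT material; the refutation concerns the TYPED schema at junk values of
its free binders (it says "weaker-typed than print", not "print is wrong"); nothing here bears on, or takes a side
on, [IUTchIII] Cor. 3.12 or any author; typed ≠ proved.
-/

noncomputable section

namespace Literature.AnabelianGeometry.EtaleTheta

open CategoryTheory Opposite Function Literature.AlgebraicGeometry.Frobenioids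
open Literature.AnabelianGeometry.SemiGraphs

namespace BiKummerSetting

open Toy

/-- **F-0493 — the universal closure of `Thm44_i` is FALSE (kernel `¬ ∀` over ALL its binders at universe
level `0`), lever T44-L09**: two canonical-model §4 settings over the perfect toy tempered Frobenioid with the
trivial Galois surjections, over the tempered groups `Π₁ = G_{ℚ̄}` (trivial) and `Π₂ = G_{ℚ₂}` (infinite, slim),
and `Ψ = Ψ^bs = 𝟭` between them: all of `Thm44Hyp` holds, but "`Ψ^bs` induces `H_{⊙,1} ⥲ H_{⊙,2}`" — typed
`Nonempty (S₁.Hodot ≃* S₂.Hodot)` — fails, `H_{⊙,1} = Π₁ = 1`, `H_{⊙,2} = Π₂` infinite.  (Print's `D_i` IS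
`B^temp(Π^tp_{X_i})⁰[𝒟_i]`, whence [SemiAnbd] Prop 3.2 / Thm A.4 — sub-DAG row T44-L09 `HodotCompatible`; the typed
`Thm44Hyp` does not tie `D_i` to `Π^tp_{X_i}`.)  So the FACT-LIST row is a SCHEMA, consumable only through its
instance theorems (`Thm44Hyp.thm44_i_of`, `thm44_i_of_inputs`, `thm44_i_of_thm34`, `thm44_i_treeVocab`,
`thm44_i_ofEmbedded`, `thm44_i_mkOfConnectedTemperoid`). [cite: MochizukiEtTh2009, Thm 4.4 (i) p.94] -/
theorem not_forall_thm44_i :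
    ¬ ∀ {K : Type} [Field K] {D₀ : Type} [Category.{0} D₀] {V : FrdIMonoidStub.{0}} {K' : Type} [Field K']
        {X₁ : SemiGraphs.TemperedArithmeticGroup.{0} K} {X₂ : SemiGraphs.TemperedArithmeticGroup.{0} K'}
        {D₀' : Type} [Category.{0} D₀'] {T₁ : RealifiedDivisorMonoids (D₀ := D₀) V}
        {T₂ : RealifiedDivisorMonoids (D₀ := D₀') V} {D₁ D₂ : Type} [Category.{0} D₁] [Category.{0} D₂]
        {VD₁ : FrdICatStub.{0, 0, 0} D₁} {VD₂ : FrdICatStub.{0, 0, 0} D₂}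
        {S₁ : BiKummerSetting X₁ T₁ D₁ VD₁} {S₂ : BiKummerSetting X₂ T₂ D₂ VD₂} (h : Thm44Hyp S₁ S₂),
        Thm44_i h := by
  intro H
  /- (1) `Π₁ := G_{ℚ̄}` — trivial, with the identity augmentation: the degenerate inhabitant of the
  [SemiAnbd] Ex 3.10 interface over the algebraically closed field `ℚ̄` (pattern of
  `TemperedArithmeticGroup.nonempty_of_isAlgClosed`), built inline so that `Π₁` is KNOWN to be trivial. -/
  haveI hsub : Subsingleton (Field.absoluteGaloisGroup Kbar) := by
    refine ⟨fun σ τ => AlgEquiv.ext fun x => ?_⟩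
    obtain ⟨k, rfl⟩ :=
      (IsAlgClosed.algebraMap_bijective_of_isIntegral (k := Kbar) (K := AlgebraicClosure Kbar)).2 x
    rw [AlgEquiv.commutes, AlgEquiv.commutes]
  haveI : _root_.IsGalois Kbar (AlgebraicClosure Kbar) := {}
  haveI : CompactSpace (Field.absoluteGaloisGroup Kbar) := by
    change CompactSpace (AlgebraicClosure Kbar ≃ₐ[Kbar] AlgebraicClosure Kbar); infer_instance
  haveI : T2Space (Field.absoluteGaloisGroup Kbar) := krullTopology_t2
  haveI : TotallyDisconnectedSpace (Field.absoluteGaloisGroup Kbar) := by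
    change TotallyDisconnectedSpace (AlgebraicClosure Kbar ≃ₐ[Kbar] AlgebraicClosure Kbar); infer_instance
  have hT₁ : IsTempered (Field.absoluteGaloisGroup Kbar) := IsTempered.of_profinite
  let aug₁ : Field.absoluteGaloisGroup Kbar →ₜ* Field.absoluteGaloisGroup Kbar := ContinuousMonoidHom.id _
  have hker₁ : IsClosed (aug₁.toMonoidHom.ker : Set (Field.absoluteGaloisGroup Kbar)) := by
    rw [MonoidHom.coe_ker]
    exact isClosed_singleton.preimage (map_continuous aug₁)
  let X₁ : SemiGraphs.TemperedArithmeticGroup.{0} Kbar :=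
    { Pi := Field.absoluteGaloisGroup Kbar
      isTempered := hT₁
      aug := aug₁
      aug_surjective := fun g => ⟨g, rfl⟩
      isTempered_ker := hT₁.subgroup_of_isClosed _ hker₁
      isSlimGroup := ⟨fun _ _ => Subsingleton.elim _ _⟩
      isSlimGroup_ker := ⟨fun _ _ => Subsingleton.elim _ _⟩
      secondCountableTopology := secondCountableTopology_of_countable_openSubgroup }
  /- (2) `Π₂ := G_{ℚ₂}` with the identity augmentation (abc-iut-w5-d218's
  `TemperedArithmeticGroup.nonempty_model_padic`, inlined): profinite hence tempered, slim
  (`galoisMLF_slim_holds`), Galois-countable. -/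
  haveI : _root_.IsGalois ℚ_[2] (AlgebraicClosure ℚ_[2]) := {}
  haveI : CompactSpace (Field.absoluteGaloisGroup ℚ_[2]) := by
    change CompactSpace (AlgebraicClosure ℚ_[2] ≃ₐ[ℚ_[2]] AlgebraicClosure ℚ_[2]); infer_instance
  haveI : T2Space (Field.absoluteGaloisGroup ℚ_[2]) := krullTopology_t2
  haveI : TotallyDisconnectedSpace (Field.absoluteGaloisGroup ℚ_[2]) := by
    change TotallyDisconnectedSpace (AlgebraicClosure ℚ_[2] ≃ₐ[ℚ_[2]] AlgebraicClosure ℚ_[2])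
    infer_instance
  have hT₂ : IsTempered (Field.absoluteGaloisGroup ℚ_[2]) := IsTempered.of_profinite
  have hSlim₂ : IsSlimGroup (Field.absoluteGaloisGroup ℚ_[2]) :=
    Literature.AnabelianGeometry.AbsoluteAnabelian.galoisMLF_slim_holds 2 ℚ_[2]
  let aug₂ : Field.absoluteGaloisGroup ℚ_[2] →ₜ* Field.absoluteGaloisGroup ℚ_[2] :=
    ContinuousMonoidHom.id _
  have hmem₂ : ∀ g : Field.absoluteGaloisGroup ℚ_[2], g ∈ aug₂.toMonoidHom.ker ↔ g = 1 := fun g =>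
    MonoidHom.mem_ker
  haveI hsub₂ : Subsingleton aug₂.toMonoidHom.ker :=
    ⟨fun a b => Subtype.ext (((hmem₂ _).mp a.2).trans ((hmem₂ _).mp b.2).symm)⟩
  have hker₂ : IsClosed (aug₂.toMonoidHom.ker : Set (Field.absoluteGaloisGroup ℚ_[2])) := by
    rw [MonoidHom.coe_ker]
    exact isClosed_singleton.preimage (map_continuous aug₂)
  let X₂ : SemiGraphs.TemperedArithmeticGroup.{0} ℚ_[2] :=
    { Pi := Field.absoluteGaloisGroup ℚ_[2]
      isTempered := hT₂
      aug := aug₂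
      aug_surjective := fun g => ⟨g, rfl⟩
      isTempered_ker := hT₂.subgroup_of_isClosed _ hker₂
      isSlimGroup := hSlim₂
      isSlimGroup_ker := ⟨fun _ _ => Subsingleton.elim _ _⟩
      secondCountableTopology := secondCountableTopology_absoluteGaloisGroup_padic 2 }
  /- (3) the two §4 settings: the canonical model over the perfect toy tempered Frobenioid, Galois objects := all,
  `Π^tp_{X_i} ↠ Aut_D(A^bs)` := trivial, `(N,H)`-slot := `True`, `A_⊙ := (∗, 0)` — exactly as
  `Toy.biKummerSetting`, over `X₁` resp. `X₂`. -/
  let S₁ : BiKummerSetting X₁ realifiedQ (Discrete PUnit.{1}) catVocab :=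
    BiKummerSetting.mkOfModelCanonical X₁ temperedFrobenioidQ temperedFrobenioidQ_monoidType
      temperedFrobenioidQ_isPerfect (fun _ => True) (fun _ _ => 1)
      (fun A _ σ => ⟨1, Iso.ext (Subsingleton.elim _ _)⟩) (fun _ _ _ => True) Toy.Aodot
      Toy.isFrobeniusTrivial_Aodot trivial
  let S₂ : BiKummerSetting X₂ realifiedQ (Discrete PUnit.{1}) catVocab :=
    BiKummerSetting.mkOfModelCanonical X₂ temperedFrobenioidQ temperedFrobenioidQ_monoidType
      temperedFrobenioidQ_isPerfect (fun _ => True) (fun _ _ => 1)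
      (fun A _ σ => ⟨1, Iso.ext (Subsingleton.elim _ _)⟩) (fun _ _ _ => True) Toy.Aodot
      Toy.isFrobeniusTrivial_Aodot trivial
  have hS₁ : S₁.Hodot = ⊤ := MonoidHom.ker_one
  have hS₂ : S₂.Hodot = ⊤ := MonoidHom.ker_one
  /- (4) `Ψ = Ψ^bs = 𝟭` inhabits `Thm44Hyp S₁ S₂` (same Frobenioid on both sides). -/
  let h : Thm44Hyp S₁ S₂ :=
    { isNonDilating₁ := fun _ _ => trivial
      isNonDilating₂ := fun _ _ => trivial
      baseShape₁ := baseShape_toy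
      baseShape₂ := baseShape_toy
      isOpen_Hodot₁ := by rw [hS₁, Subgroup.coe_top]; exact isOpen_univ
      isOpen_Hodot₂ := by rw [hS₂, Subgroup.coe_top]; exact isOpen_univ
      Ψ := CategoryTheory.Equivalence.refl
      Ψbs := CategoryTheory.Equivalence.refl
      comm := S₁.base.rightUnitor ≪≫ S₁.base.leftUnitor.symm
      mapsAodot := ⟨Iso.refl _⟩ }
  /- (5) clause 3 of (i) fails: `H_{⊙,2} = G_{ℚ₂}` is infinite, `H_{⊙,1} ≤ G_{ℚ̄}` is trivial. -/
  obtain ⟨e⟩ := (H h).2.2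
  have hInf : Infinite S₂.Hodot := by
    rw [hS₂]
    exact (Equiv.infinite_iff (Subgroup.topEquiv : (⊤ : Subgroup X₂.Pi) ≃* X₂.Pi).toEquiv).mpr
      (Padic.infinite_absoluteGaloisGroup 2)
  haveI : Subsingleton S₂.Hodot := e.symm.injective.subsingleton
  exact hInf.not_finite (Finite.of_subsingleton)

end BiKummerSetting

end Literature.AnabelianGeometry.EtaleTheta

end
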